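import Summits.BirchSwinnertonDyer.BirchSwinnertonDyer.Theorems.AdditiveKolyvaginRoadLevelSystems
import Summits.BirchSwinnertonDyer.BirchSwinnertonDyer.Theorems.Rank1ResidualJetKolyvaginDecompositionTrivial
import Summits.BirchSwinnertonDyer.BirchSwinnertonDyer.Theorems.KolyvaginRoadThreeMethod2KolyvaginTransverseIsotropy
import HarnessLib

/-!
# Route `AdditiveKolyvaginRoad`, crux `KolyvaginPrimitiveAdditive` (item stmt-BirchSwinnertonDyer-20132):
# stub LOC, input (Tr-iso) at a GENERAL prime `p` — THE TRANSVERSE CONDITION AT A KOLYVAGIN PRIME IS ISOTROPIC for the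
# local Weil cup product
# (cell `pub/bsd-wall`, lead prover `bsd-wall-akr-p1` g3; `--supports stmt-BirchSwinnertonDyer-20132`, helper;
# p-generic port of zhang3-p1's `Theorems/KolyvaginRoadThreeMethod2KolyvaginTransverseIsotropy.lean` over the bsd-jet
# cell's general-`p` local Galois picture `Rank1ResidualJetKolyvaginDecompositionTrivial`)

WHY THIS FILE. After `kolyvaginLocalPackageP_of_kolyvaginPrimePackage` (p533303) stub LOC of skeleton v7.1 of crux
20132 is the Kolyvagin-prime local package in cup-product currency — (Tr-iso), (Perf), (Line) — plus (Supply). This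
file DISCHARGES (Tr-iso) at every ODD prime `p`: after its first three arguments (`hK ι hp2`) its main theorem has
literally the type of the binder `hisoTr` of `kolyvaginLocalPackageP_of_kolyvaginPrimePackage`.

WHAT. `K` imaginary quadratic, `ι : K → ℂ`, `ℓ` a Kolyvagin prime of W. Zhang at `p` (`Zhang2014.IsKolyvaginPrime`),
`v ∋ ℓ` its place, `e` any `Γ_K`-equivariant bi-additive `μ_p`-valued pairing on `E[p]`; for `x, y` in the TRANSVERSE
condition `transverseLocalKerP W K p ι ℓ v` (p523723), `loc_v x ∪ₑ loc_v y = 0` in `H²(K_v, μ_p)`. Mechanism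
(Mazur–Rubin Prop. 1.3.2 (ii); zhang3-p1's proof verbatim up to `3 ↦ p = 2k + 1`): the decomposition group `G_𝔓` of the
prime `𝔓` of `\bar ℤ_K` cut out by `K̄ → \bar K_v` acts TRIVIALLY on `E[p]` (bsd-jet:
`JET.GlobalDuality.smul_torsion_eq_self_of_mem_decompositionSubgroup`, level `p¹`) and fixes every `K`-embedded
Hilbert class field `K[1]` (§1, `λ = (ℓ)` principal), so the restriction `χ : Γ_{K_v} → Gal(K[ℓ]/K)` lands in the
CYCLIC `G_ℓ = Gal(K[ℓ]/K[1])`; the cocycles of two transverse classes vanish on `ker χ` and take `G_𝔓`-fixed values,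
and the cup product of two such classes on a cyclic quotient with trivial action is symmetric, hence killed by the odd
exponent `p` (`TransverseCup.cupClass_eq_zero_of_fixed_of_cyclic`).
* §1 `smul_ringClassFieldOne_eq_self_of_mem_decompositionSubgroup_P` — `G_𝔓` fixes `K[1] ⊆ K̄` pointwise (any
  `K`-embedding), for a Kolyvagin prime at ANY `p` (zhang3-p1's §E verbatim: the statement never used `p = 3`).
* §2 `cupProduct_eq_zero_of_mem_transverseLocalKerP` — (Tr-iso) at a general prime, in the binder shape of
  `kolyvaginLocalPackageP_of_kolyvaginPrimePackage`.
The compactness of the absolute Galois groups of the completions (a local instance in the tree's cup-product files) is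
an instance binder (a proposition).

HONEST FRAMING: theorems only; 0 definitions, 0 named facts, 0 `sorry`; closes nothing by itself (reduces stub LOC to
(Perf) + (Line) + (Supply)).

References: [cite: WZhang2014, §8.1 (H¹_tr), Lemma 8.4] [cite: MazurRubin2004, Prop. 1.3.2 (ii)] [cite: GrossLMS1991,
§3 (proof of Prop. 3.7), §4] [cite: NeukirchANT1999, Ch. I §9 Prop. (9.4)] [cite: Marcus2018, Ch. 4, remark after
Thm. 32].
-/

-- single-conjunct summit: `Summit.BirchSwinnertonDyer.BirchSwinnertonDyer.…` repeats the name by design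
set_option linter.dupNamespace false

noncomputable section

open scoped Classical Pointwise

namespace Summit.BirchSwinnertonDyer.BirchSwinnertonDyer.Theorems.AdditiveKoly

open CategoryTheory WeierstrassCurve Field Function NumberField IsDedekindDomain
open Literature.NumberTheory.EllipticCurves Literature.NumberTheory.EllipticCurves.ModularForms
  Literature.NumberTheory.GaloisRepresentations Module
open Literature.NumberTheory.GaloisRepresentations.DiscreteGaloisModule (mu MuCarrier)
open Literature.NumberTheory.GaloisCohomology
open Summit.BirchSwinnertonDyer.Rank1Residual.X11b.Three.Koly.Method2
open Summit.BirchSwinnertonDyer.Rank1Residual.GaloisImage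
open Summit.BirchSwinnertonDyer.Rank1Residual.JET Summit.BirchSwinnertonDyer.Rank1Residual.X11b
open scoped ContRepresentation

variable (W : WeierstrassCurve ℚ) (K : Type) [Field K] [NumberField K] (p : ℕ) [W.IsElliptic] [W.IsGloballyMinimal]

/-! ## §1 The decomposition group at `λ` fixes the embedded Hilbert class field `K[1]` -/

omit [W.IsElliptic] in
/-- **`G_𝔓` fixes `K[1] ⊆ K̄` pointwise, `𝔓` any prime of `\bar ℤ_K` above the place `λ = (ℓ)` of a Kolyvagin prime
at any `p`** (any `K`-embedding `e₁ : K[1] → K̄`): `λ` is principal, so splits completely in the Hilbert class field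
(`mem_splitPrimes_ringClassField_of_span_natCast`); a Frobenius at `𝔓` fixes `e₁(K[1])`, so does every inertia
element (a quotient of two Frobenius elements), and `G_𝔓` is generated by a Frobenius, the inertia group and the open
subgroup `Gal(K̄/e₁(K[1]))`. zhang3-p1's §E with `3 ↦ p` (the proof never used `p`). [cite: GrossLMS1991, §3 (proof of
Prop. 3.7)] [cite: Marcus2018, Ch. 4, remark after Thm. 32] -/
theorem smul_ringClassFieldOne_eq_self_of_mem_decompositionSubgroup_P (hK : IsImaginaryQuadratic K) (ι : K →+* ℂ)
    {ℓ : ℕ} (hℓ : Zhang2014.IsKolyvaginPrime (W.conductorNorm ℤ) W K p ℓ) (w : HeightOneSpectrum (𝓞 K))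
    (hw : (ℓ : 𝓞 K) ∈ w.asIdeal) {𝔓 : Ideal (absIntegers (𝓞 K) K)} (h𝔓 : 𝔓 ∈ w.primesAbove)
    (e₁ : ringClassField K ι 1 →ₐ[K] AlgebraicClosure K) {d : absoluteGaloisGroup K}
    (hd : d ∈ 𝔓.decompositionSubgroup (absoluteGaloisGroup K)) (y : ringClassField K ι 1) :
    d • e₁ y = e₁ y := by
  have hℓp : ℓ.Prime := hℓ.1
  have hℓP : (Ideal.span {(ℓ : 𝓞 K)}).IsPrime := hℓ.2.2.2.2.1
  haveI := (finiteDimensional_and_isGalois_ringClassField hK ι one_ne_zero).1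
  haveI := (finiteDimensional_and_isGalois_ringClassField hK ι one_ne_zero).2
  haveI : NumberField (ringClassField K ι 1) := NumberField.of_module_finite K _
  -- `w = (ℓ)` splits completely in `K[1]`
  have hwℓ : w.asIdeal = Ideal.span {((ℓ : ℕ) : 𝓞 K)} := by
    have hne : Ideal.span {(ℓ : 𝓞 K)} ≠ ⊥ := by
      rw [Ne, Ideal.span_singleton_eq_bot]; exact_mod_cast hℓp.ne_zero
    exact ((hℓP.isMaximal hne).eq_of_le w.isPrime.ne_top ((Ideal.span_singleton_le_iff_mem _).mpr hw)).symm
  have hsplit : w ∈ splitPrimes K (ringClassField K ι 1) :=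
    mem_splitPrimes_ringClassField_of_span_natCast hK ι one_ne_zero hwℓ (Nat.coprime_one_right ℓ)
  -- Frobenius elements at `𝔓` fix `e₁(K[1])`; so do inertia elements (`i = (iF)F⁻¹`)
  obtain ⟨F, hF⟩ := HeightOneSpectrum.exists_isArithFrobAt_of_mem_primesAbove_holds h𝔓
  have hFrob : ∀ {Φ : absoluteGaloisGroup K}, IsArithFrobAt (𝓞 K) Φ 𝔓 → ∀ z, Φ • e₁ z = e₁ z :=
    fun hΦ z ↦ smul_algHom_eq_self_of_mem_splitPrimes e₁ hsplit h𝔓 hΦ z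
  have hIner : ∀ i ∈ 𝔓.inertia (absoluteGaloisGroup K), ∀ z, i • e₁ z = e₁ z := by
    intro i hi z
    have h1 : (i * F) • e₁ z = e₁ z := hFrob ((isArithFrobAt_mul_iff_of_mem_inertia hi).mpr hF) z
    rw [mul_smul, hFrob hF z] at h1
    exact h1
  have hpow : ∀ (n : ℕ) z, (F ^ n) • e₁ z = e₁ z := by
    intro n z
    induction n with
    | zero => rw [pow_zero, one_smul]
    | succ n ih => rw [pow_succ, mul_smul, hFrob hF z, ih]
  -- the open subgroup fixing `e₁(K[1])`
  haveI : FiniteDimensional K e₁.fieldRange :=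
    LinearEquiv.finiteDimensional (AlgEquiv.ofInjectiveField e₁).toLinearEquiv
  let U : Subgroup (absoluteGaloisGroup K) := e₁.fieldRange.fixingSubgroup
  have hU : IsOpen (U : Set (absoluteGaloisGroup K)) := IntermediateField.fixingSubgroup_isOpen e₁.fieldRange
  obtain ⟨n, i, u, hi, hu, rfl⟩ := exists_eq_frobenius_pow_mul_of_mem_decompositionSubgroup h𝔓 hF hU hd
  have huz : u • e₁ y = e₁ y := by
    have hy : e₁ y ∈ e₁.fieldRange := ⟨y, rfl⟩
    exact (mem_fixingSubgroup_iff_forall_smul e₁.fieldRange u).mp hu ⟨e₁ y, hy⟩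
  rw [mul_smul, mul_smul, huz, hIner i hi, hpow]

/-! ## §2 (Tr-iso) at a general prime -/

variable [Fact p.Prime] [∀ v : Place K, CompactSpace (absoluteGaloisGroup (Place.Completion v))]

/-- **(Tr-iso) at a general prime `p`: the transverse condition at a Kolyvagin prime is isotropic for the local Weil
cup product.** `K` imaginary quadratic, `ι : K → ℂ`, `ℓ` a Kolyvagin prime of W. Zhang at `p`, `v ∋ ℓ` its place, `e`
any `Γ_K`-equivariant bi-additive `μ_p`-valued pairing on `E[p]`; for `x, y ∈ transverseLocalKerP W K p ι ℓ v`,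
`loc_v x ∪ₑ loc_v y = 0` in `H²(K_v, μ_p)`, for `p` ODD. After `hK ι hp2` this is literally the binder `hisoTr` of
`kolyvaginLocalPackageP_of_kolyvaginPrimePackage`. [cite: WZhang2014, §8.1 (H¹_tr), Lemma 8.4 (proof)]
[cite: MazurRubin2004, Prop. 1.3.2 (ii)] [cite: GrossLMS1991, §3–§4] -/
theorem cupProduct_eq_zero_of_mem_transverseLocalKerP (hK : IsImaginaryQuadratic K) (ι : K →+* ℂ) (hp2 : p ≠ 2)
    (e : geomTorsion (W.baseChange K) ((p ^ 1 : ℕ) : ℤ) → geomTorsion (W.baseChange K) ((p ^ 1 : ℕ) : ℤ) →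
      AlgebraicClosure K)
    (hμ : ∀ P Q, e P Q ^ (p ^ 1) = 1) (hadd₁ : ∀ P₁ P₂ Q, e (P₁ + P₂) Q = e P₁ Q * e P₂ Q)
    (hadd₂ : ∀ P Q₁ Q₂, e P (Q₁ + Q₂) = e P Q₁ * e P Q₂)
    (hgal : ∀ (σ : absoluteGaloisGroup K) (P Q : geomTorsion (W.baseChange K) ((p ^ 1 : ℕ) : ℤ)),
      σ • e P Q = e (σ • P) (σ • Q))
    (ℓ : ℕ) (hℓ : Zhang2014.IsKolyvaginPrime (W.conductorNorm ℤ) W K p ℓ) (v : HeightOneSpectrum (𝓞 K))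
    (hv : ((ℓ : ℕ) : 𝓞 K) ∈ v.asIdeal) (x y : Vp W K p) (hx : x ∈ transverseLocalKerP W K p ι ℓ v)
    (hy : y ∈ transverseLocalKerP W K p ι ℓ v) :
    (weilContPairingLocal (W.baseChange K) (p ^ 1) e hμ hadd₁ hadd₂ hgal (Sum.inr v)).cupProduct
      (galoisCohomology.localization ((W.baseChange K).torsionGaloisModule ((p ^ 1 : ℕ) : ℤ)) (Sum.inr v) 1 x)
      (galoisCohomology.localization ((W.baseChange K).torsionGaloisModule ((p ^ 1 : ℕ) : ℤ)) (Sum.inr v) 1 y)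
        = 0 := by
  have hp : p.Prime := Fact.out
  haveI : NeZero (p ^ 1 : ℕ) := ⟨pow_ne_zero 1 hp.ne_zero⟩
  -- the binder instance at the place `Sum.inr v`, in `adicCompletion` spelling
  haveI : CompactSpace (absoluteGaloisGroup (v.adicCompletion K)) :=
    ‹∀ v : Place K, CompactSpace (absoluteGaloisGroup (Place.Completion v))› (Sum.inr v)
  have hℓp : ℓ.Prime := hℓ.1
  have hℓ0 : ℓ ≠ 0 := hℓp.ne_zero
  have hℓP : (Ideal.span {(ℓ : 𝓞 K)}).IsPrime := hℓ.2.2.2.2.1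
  have hk1 : 1 ≤ Zhang2014.kolyvaginIndex W p ℓ := hℓ.2.2.2.2.2
  haveI := (finiteDimensional_and_isGalois_ringClassField hK ι hℓ0).1
  haveI := (finiteDimensional_and_isGalois_ringClassField hK ι hℓ0).2
  haveI := (finiteDimensional_and_isGalois_ringClassField hK ι one_ne_zero).1
  haveI : FiniteDimensional ℚ (ringClassField K ι ℓ) := Module.Finite.trans K (ringClassField K ι ℓ)
  set Kv := v.adicCompletion K with hKv
  set ι₀ := closureEmb (K := K) Kv with hι₀
  obtain ⟨𝔐, h𝔐⟩ := v.localPrimesAbove_nonempty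
  set 𝔓 := v.primeBelow ι₀ 𝔐 with h𝔓def
  have h𝔓 : 𝔓 ∈ v.primesAbove := HeightOneSpectrum.primeBelow_mem_primesAbove h𝔐
  -- `res Γ_{K_v} ⊆ G_𝔓 ⊆ Γ_{K(E[p])}`
  have hres : ∀ s : absoluteGaloisGroup Kv,
      absGaloisRestrict K Kv s ∈ 𝔓.decompositionSubgroup (absoluteGaloisGroup K) := fun s ↦ by
    rw [← resGal_eq_absGaloisRestrict, resGal_eq]
    exact resGalOfEmb_mem_decompositionSubgroup ι₀ h𝔐 s
  have hfix : ∀ (s : absoluteGaloisGroup Kv) (Q : geomTorsion (W.baseChange K) ((p ^ 1 : ℕ) : ℤ)),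
      absGaloisRestrict K Kv s • Q = Q := fun s Q ↦
    GlobalDuality.smul_torsion_eq_self_of_mem_decompositionSubgroup W K hK hℓ hk1 v hv h𝔓 (hres s) Q
  have htf : ∀ s : absoluteGaloisGroup Kv,
      absGaloisRestrict K Kv s ∈ torsionFixing (W.baseChange K) ((p ^ 1 : ℕ) : ℤ) := fun s ↦
    GlobalDuality.decompositionSubgroup_le_torsionFixing W K hK hℓ hk1 v hv h𝔓 (hres s)
  -- the restriction `χ : Γ_{K_v} → Gal(K[ℓ]/K)` along a `K`-embedding `e₀ : K[ℓ] → K̄`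
  let e₀ : ringClassField K ι ℓ →ₐ[K] AlgebraicClosure K := IsAlgClosed.lift
  obtain ⟨π, hπ⟩ := KolyvaginH44.exists_absGaloisRestrict hK ι ℓ e₀
  let χ : absoluteGaloisGroup Kv →* ringClassGal ι ℓ := π.comp (absGaloisRestrict K Kv).toMonoidHom
  have hχ : ∀ s, χ s = π (absGaloisRestrict K Kv s) := fun _ ↦ rfl
  -- `ker χ ⊆` the stabiliser of `K[ℓ]` (all embeddings)
  have hker : ∀ s, χ s = 1 → absGaloisRestrict K Kv s ∈ ringClassStabilizer K ι ℓ ℓ := by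
    intro s hs
    refine KolyLocal.mem_ringClassStabilizer_of_forall_smul_eq K hK ι hℓ0 e₀ fun z ↦ ?_
    rw [hπ, ← hχ, hs, OneMemClass.coe_one, AlgEquiv.one_apply]
  -- the image of `χ` lies in `G_ℓ = Gal(K[ℓ]/K[1])`, a cyclic group
  have h1ℓ : ringClassField K ι 1 ≤ ringClassField K ι ℓ := ringClassField_mono hK ι (one_dvd ℓ) hℓ0
  have himg : ∀ s, ((χ s : ringClassGal ι ℓ) : ringClassField K ι ℓ ≃ₐ[ℚ] ringClassField K ι ℓ) ∈
      ringClassGalOver ι ℓ 1 := by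
    intro s
    rw [ringClassGalOver, mem_fixingSubgroup_iff]
    intro z hz
    rw [AlgEquiv.smul_def]
    -- `z ∈ K[ℓ]` with `(z : ℂ) ∈ K[1]` comes from `K[1]`
    obtain ⟨z₁, hz₁⟩ : ∃ z₁ : ringClassField K ι 1, RingClassField.inclusion ι h1ℓ z₁ = z :=
      ⟨⟨(z : ℂ), hz⟩, Subtype.ext (RingClassField.coe_inclusion ι h1ℓ _)⟩
    have key : e₀ (((χ s : ringClassGal ι ℓ) : ringClassField K ι ℓ ≃ₐ[ℚ] ringClassField K ι ℓ) z) = e₀ z := by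
      rw [hχ, ← hπ, ← hz₁]
      exact smul_ringClassFieldOne_eq_self_of_mem_decompositionSubgroup_P W K p hK ι hℓ v hv h𝔓
        (e₀.comp (RingClassField.inclusion ι h1ℓ)) (hres s) z₁
    exact e₀.injective key
  have hcycG : IsCyclic (ringClassGalOver ι ℓ 1) := by
    have h := RingClassGalOverCyclic.isCyclic_ringClassGalOver hK ι (ℓ := ℓ) (m' := 1) one_ne_zero hℓp
      (fun h ↦ hℓp.one_lt.ne' (Nat.dvd_one.mp h)) hℓP
    rwa [Nat.mul_one] at h
  have hcyc : ∃ σ : absoluteGaloisGroup Kv, ∀ s, ∃ i : ℕ, χ s = χ σ ^ i := by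
    -- `χ` corestricted to the cyclic `G_ℓ`
    let ψ : absoluteGaloisGroup Kv →* ringClassGalOver ι ℓ 1 :=
      ((ringClassGal ι ℓ).subtype.comp χ).codRestrict (ringClassGalOver ι ℓ 1) (fun s ↦ himg s)
    have hψ : ∀ s, ((ψ s : ringClassGalOver ι ℓ 1) : ringClassField K ι ℓ ≃ₐ[ℚ] ringClassField K ι ℓ) =
        (χ s : ringClassField K ι ℓ ≃ₐ[ℚ] ringClassField K ι ℓ) := fun _ ↦ rfl
    haveI : IsCyclic ψ.range := isCyclic_of_injective ψ.range.subtype ψ.range.subtype_injective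
    obtain ⟨g₀, hg₀⟩ := IsCyclic.exists_monoid_generator (α := ψ.range)
    obtain ⟨σ, hσ⟩ := MonoidHom.mem_range.mp g₀.2
    refine ⟨σ, fun s ↦ ?_⟩
    obtain ⟨i, hi⟩ := (Submonoid.mem_powers_iff _ _).mp (hg₀ ⟨ψ s, ⟨s, rfl⟩⟩)
    refine ⟨i, Subtype.ext ?_⟩
    have h1 : ((g₀ ^ i : ψ.range) : ringClassGalOver ι ℓ 1) = ψ s := congrArg Subtype.val hi
    rw [SubmonoidClass.coe_pow, ← hσ] at h1
    have h2 := congrArg (fun t : ringClassGalOver ι ℓ 1 ↦ (t : ringClassField K ι ℓ ≃ₐ[ℚ] ringClassField K ι ℓ))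
      h1
    simp only [SubmonoidClass.coe_pow, hψ] at h2
    rw [SubmonoidClass.coe_pow]
    exact h2.symm
  -- the classes as explicit cocycles on `Γ_{K_v}`
  set φx := reprCocycle (W.baseChange K) ((p ^ 1 : ℕ) : ℤ) x with hφx
  set φy := reprCocycle (W.baseChange K) ((p ^ 1 : ℕ) : ℤ) y with hφy
  rw [← oneCocycleClass_reprCocycle (W.baseChange K) ((p ^ 1 : ℕ) : ℤ) x,
    ← oneCocycleClass_reprCocycle (W.baseChange K) ((p ^ 1 : ℕ) : ℤ) y]
  change (weilContPairingLocal (W.baseChange K) (p ^ 1) e hμ hadd₁ hadd₂ hgal (Sum.inr v)).cupProduct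
      (galoisCohomology.res ((W.baseChange K).torsionGaloisModule ((p ^ 1 : ℕ) : ℤ)) Kv 1
        (oneCocycleClass (discreteTopRep (absoluteGaloisGroup K) (geomTorsion (W.baseChange K) ((p ^ 1 : ℕ) : ℤ)))
          φx))
      (galoisCohomology.res ((W.baseChange K).torsionGaloisModule ((p ^ 1 : ℕ) : ℤ)) Kv 1
        (oneCocycleClass (discreteTopRep (absoluteGaloisGroup K) (geomTorsion (W.baseChange K) ((p ^ 1 : ℕ) : ℤ)))
          φy)) = 0
  rw [res_torsionGaloisModule_oneCocycleClass (W.baseChange K) ((p ^ 1 : ℕ) : ℤ) Kv φx,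
    res_torsionGaloisModule_oneCocycleClass (W.baseChange K) ((p ^ 1 : ℕ) : ℤ) Kv φy]
  erw [ContPairing.cupProduct_oneCocycleClass]
  -- the Mazur–Rubin mechanism on the cyclic quotient, odd exponent `p = 2k + 1`
  obtain ⟨k, hk⟩ : ∃ k, p = 2 * k + 1 := hp.odd_of_ne_two hp2
  refine TransverseCup.cupClass_eq_zero_of_fixed_of_cyclic _ χ _ _ (fun s t ↦ ?_) (fun s t ↦ ?_)
    (fun s hs ↦ ?_) (fun s hs ↦ ?_) hcyc k (fun z ↦ ?_)
  · -- values fixed (`G_𝔓` acts trivially on `E[p]`)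
    rw [contOneCocycles.pullback_apply]
    exact hfix t _
  · rw [contOneCocycles.pullback_apply]
    exact hfix t _
  · -- vanishing on `ker χ`: transversality of `x`
    rw [contOneCocycles.pullback_apply]
    change φx.1 (absGaloisRestrict K Kv s) = 0
    exact (mem_transverseLocalKerP_iff.mp hx) 𝔓 h𝔓 _ (hres s) (hker s hs) (htf s)
  · rw [contOneCocycles.pullback_apply]
    change φy.1 (absGaloisRestrict K Kv s) = 0
    exact (mem_transverseLocalKerP_iff.mp hy) 𝔓 h𝔓 _ (hres s) (hker s hs) (htf s)
  · -- `p • μ_p = 0`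
    have hcast : ((2 * k + 1 : ℕ) : ℤ) = ((p ^ 1 : ℕ) : ℤ) := by rw [pow_one, hk]
    have hpz : (2 * k + 1) • z = ((p ^ 1 : ℕ) : ℤ) • z := by
      rw [← natCast_zsmul, ← hcast]
    rw [hpz]
    exact zsmul_muCarrier_eq_zero K (p ^ 1) z

end Summit.BirchSwinnertonDyer.BirchSwinnertonDyer.Theorems.AdditiveKoly

end
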